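import Mathlib

/-!
# Stub `stub_limitTails` of line `Sketch` for crux `TameOrBrodyR4` (stmt-SmoothPoincare4-7826, route SullivanDual)

Tails of a locally uniform limit of pencil members (pure metric topology, no complex analysis).
Setting: `ℝ⁴ = EuclideanSpace ℝ (Fin 4)` with two real-linear coordinates `P Q : ℝ⁴ →L[ℝ] ℂ`, a
sequence `u n : ℂ → ℝ⁴` converging locally uniformly to a continuous `v : ℂ → ℝ⁴`, and asymptotic
values `b n → b⋆`. Assume that every `u n` crosses each far line `{P = c}`, `|c| > 2R`, and that the
tail estimates `|P (u n ξ) - ξ| ≤ 120R²/|ξ|` (`|ξ| ≥ 6R`) and `|Q (u n ξ) - b n| ≤ 16R²/|P (u n ξ)|`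
(`|P (u n ξ)| ≥ 4R`) hold uniformly in `n`. We prove: `Q ∘ v → b⋆` and `P (v ξ) - ξ → 0` at
infinity, the `P`-tail estimate passes to `v`, and `v` crosses every far line.

How.
* Pointwise convergence `u n ξ → v ξ` (`TendstoLocallyUniformly.tendsto_comp` with a constant
  sequence) and continuity of `P` pass the closed `P`-tail inequality to the limit
  (`le_of_tendsto'`); the majorant `120R²/|ξ| → 0` along `cocompact ℂ`
  (`tendsto_norm_cocompact_atTop`, `Filter.Tendsto.div_atTop`) then gives `P (v ξ) - ξ → 0`.
* `LimitTails.norm_sub_le_of_tails`: for `|ξ| ≥ 24R` the `P`-tail gives `|P (u n ξ) - ξ| ≤ 20R`,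
  so `|P (u n ξ)| ≥ |ξ| - 20R ≥ 4R` and the `Q`-tail applies:
  `|Q (u n ξ) - b n| ≤ 16R²/(|ξ| - 20R)`, uniformly in `n`; in the limit
  `|Q (v ξ) - b⋆| ≤ 16R²/(|ξ| - 20R) → 0`, so `Q ∘ v → b⋆` (`squeeze_zero'`).
* Crossings: pick `ξ n` with `P (u n (ξ n)) = c` (`|c| > 2R`). If `|ξ n| ≥ 6R` the `P`-tail gives
  `|c - ξ n| ≤ 20R`, so `|ξ n| ≤ max (6R) (|c| + 20R)`: the crossing parameters lie in a compact
  ball, a subsequence converges to some `ξ⋆` (`IsCompact.tendsto_subseq`), and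
  `u (φ k) (ξ (φ k)) → v ξ⋆` by locally uniform convergence along the subsequence
  (`LimitTails.tendstoLocallyUniformly_subseq`) and continuity of `v`; hence `P (v ξ⋆) = c`.

Sources: classical point-set topology (locally uniform convergence and diagonal limits), as in
M. Gromov, Invent. Math. 82 (1985), §2.4.A, where limits of pencil members inherit the
normalisation at infinity. Mathlib only.
-/

-- the registered namespace `Summit.SmoothPoincare4.SmoothPoincare4.…` repeats a component
set_option linter.dupNamespace false

noncomputable section

open scoped Topology
open Filter Set Metric

namespace Summit.SmoothPoincare4.SmoothPoincare4.Cruxes.TameOrBrodyR4.Sketch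

local notation "E4" => EuclideanSpace ℝ (Fin 4)

namespace LimitTails

/-- A subsequence of a locally uniformly convergent sequence converges locally uniformly (to the
same limit). -/
theorem tendstoLocallyUniformly_subseq {α β : Type*} [TopologicalSpace α] [UniformSpace β]
    {F : ℕ → α → β} {f : α → β} (h : TendstoLocallyUniformly F f atTop) {φ : ℕ → ℕ}
    (hφ : StrictMono φ) : TendstoLocallyUniformly (fun k => F (φ k)) f atTop := fun w hw x => by
  obtain ⟨t, ht, hev⟩ := h w hw x
  exact ⟨t, ht, hφ.tendsto_atTop.eventually hev⟩

/-- The `P`-tail majorant is at most `20R` from `|ξ| ≥ 6R` on: `120R²/|ξ| ≤ 120R²/(6R) = 20R`. -/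
theorem div_norm_le {R : ℝ} (hR : 0 < R) {ξ : ℂ} (hξ : 6 * R ≤ ‖ξ‖) :
    120 * R ^ 2 / ‖ξ‖ ≤ 20 * R := by
  have hpos : 0 < ‖ξ‖ := by linarith
  rw [div_le_iff₀ hpos]
  nlinarith

/-- **The `Q`-tail in terms of the parameter.** If `w : ℂ → ℝ⁴` satisfies the `P`-tail estimate
`|P (w ξ) - ξ| ≤ 120R²/|ξ|` for `|ξ| ≥ 6R` and the `Q`-tail estimate `|Q (w ξ) - b| ≤ 16R²/|P (w ξ)|`
for `|P (w ξ)| ≥ 4R`, then for `|ξ| ≥ 24R`: `|P (w ξ)| ≥ |ξ| - 20R ≥ 4R`, hence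
`|Q (w ξ) - b| ≤ 16R²/(|ξ| - 20R)`. -/
theorem norm_sub_le_of_tails {R : ℝ} (hR : 0 < R) (P Q : E4 →L[ℝ] ℂ) (w : ℂ → E4) (b : ℂ)
    (htP : ∀ ξ : ℂ, 6 * R ≤ ‖ξ‖ → ‖P (w ξ) - ξ‖ ≤ 120 * R ^ 2 / ‖ξ‖)
    (htQ : ∀ ξ : ℂ, 4 * R ≤ ‖P (w ξ)‖ → ‖Q (w ξ) - b‖ ≤ 16 * R ^ 2 / ‖P (w ξ)‖)
    {ξ : ℂ} (hξ : 24 * R ≤ ‖ξ‖) : ‖Q (w ξ) - b‖ ≤ 16 * R ^ 2 / (‖ξ‖ - 20 * R) := by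
  have h6 : 6 * R ≤ ‖ξ‖ := by linarith
  have h20 : ‖P (w ξ) - ξ‖ ≤ 20 * R := (htP ξ h6).trans (div_norm_le hR h6)
  have hlow : ‖ξ‖ - 20 * R ≤ ‖P (w ξ)‖ := by
    have h := norm_sub_norm_le ξ (P (w ξ))
    rw [norm_sub_rev] at h
    linarith
  have h4 : 4 * R ≤ ‖P (w ξ)‖ := by linarith
  have hpos : 0 < ‖ξ‖ - 20 * R := by linarith
  exact (htQ ξ h4).trans (div_le_div_of_nonneg_left (by positivity) hpos hlow)

/-- **Crossing parameters are bounded.** If `P (w ξ) = c` and the `P`-tail estimate holds for `w`,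
then `|ξ| ≤ max (6R) (|c| + 20R)`: either `|ξ| < 6R`, or `|c - ξ| ≤ 120R²/|ξ| ≤ 20R`. -/
theorem norm_le_of_crossing {R : ℝ} (hR : 0 < R) (P : E4 →L[ℝ] ℂ) (w : ℂ → E4) {c ξ : ℂ}
    (htP : ∀ ξ : ℂ, 6 * R ≤ ‖ξ‖ → ‖P (w ξ) - ξ‖ ≤ 120 * R ^ 2 / ‖ξ‖) (hc : P (w ξ) = c) :
    ‖ξ‖ ≤ max (6 * R) (‖c‖ + 20 * R) := by
  rcases le_or_gt (6 * R) ‖ξ‖ with h | h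
  · have h1 : ‖c - ξ‖ ≤ 20 * R := by
      have h' := htP ξ h
      rw [hc] at h'
      exact h'.trans (div_norm_le hR h)
    have h2 : ‖ξ‖ ≤ ‖c‖ + 20 * R := by
      have h' := norm_sub_norm_le ξ c
      rw [norm_sub_rev] at h'
      linarith
    exact h2.trans (le_max_right _ _)
  · exact h.le.trans (le_max_left _ _)

end LimitTails

/-- **Tails of a locally uniform limit.** If `u n → v` locally uniformly on `ℂ` (`v` continuous),
`b n → b⋆`, every `u n` crosses the far lines `{P = c}` (`|c| > 2R`) and the uniform tail
estimates `|P (u n ξ) - ξ| ≤ 120R²/|ξ|` (`|ξ| ≥ 6R`) and `|Q (u n ξ) - b n| ≤ 16R²/|P (u n ξ)|`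
(`|P (u n ξ)| ≥ 4R`) hold, then `Q ∘ v → b⋆` and `P (v ξ) - ξ → 0` at infinity, the `P`-tail
estimate passes to `v`, and `v` crosses every far line (the crossing parameters of `u n` over `c`
are bounded, and a cluster point crosses). -/
theorem stub_limitTails (R : ℝ) (hR : 0 < R) (P Q : E4 →L[ℝ] ℂ) (u : ℕ → ℂ → E4) (v : ℂ → E4)
    (b : ℕ → ℂ) (bs : ℂ) (hv : Continuous v) (hb : Tendsto b atTop (𝓝 bs))
    (hloc : TendstoLocallyUniformly u v atTop)
    (h7 : ∀ n (c : ℂ), 2 * R < ‖c‖ → ∃ ξ, P (u n ξ) = c)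
    (htP : ∀ n (ξ : ℂ), 6 * R ≤ ‖ξ‖ → ‖P (u n ξ) - ξ‖ ≤ 120 * R ^ 2 / ‖ξ‖)
    (htQ : ∀ n (ξ : ℂ), 4 * R ≤ ‖P (u n ξ)‖ → ‖Q (u n ξ) - b n‖ ≤ 16 * R ^ 2 / ‖P (u n ξ)‖) :
    Tendsto (fun ξ => Q (v ξ)) (cocompact ℂ) (𝓝 bs) ∧
      Tendsto (fun ξ => P (v ξ) - ξ) (cocompact ℂ) (𝓝 0) ∧
      (∀ ξ : ℂ, 6 * R ≤ ‖ξ‖ → ‖P (v ξ) - ξ‖ ≤ 120 * R ^ 2 / ‖ξ‖) ∧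
      (∀ c : ℂ, 2 * R < ‖c‖ → ∃ ξ, P (v ξ) = c) := by
  -- pointwise convergence `u n ξ → v ξ`
  have hpt : ∀ ξ : ℂ, Tendsto (fun n => u n ξ) atTop (𝓝 (v ξ)) := fun ξ =>
    hloc.tendsto_comp hv.continuousAt tendsto_const_nhds
  -- the closed `P`-tail inequality passes to the limit
  have h3 : ∀ ξ : ℂ, 6 * R ≤ ‖ξ‖ → ‖P (v ξ) - ξ‖ ≤ 120 * R ^ 2 / ‖ξ‖ := by
    intro ξ hξ
    have ht : Tendsto (fun n => ‖P (u n ξ) - ξ‖) atTop (𝓝 ‖P (v ξ) - ξ‖) :=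
      (((P.continuous.tendsto _).comp (hpt ξ)).sub tendsto_const_nhds).norm
    exact le_of_tendsto' ht fun n => htP n ξ hξ
  -- the `Q`-tail of the limit in terms of the parameter
  have hQv : ∀ ξ : ℂ, 24 * R ≤ ‖ξ‖ → ‖Q (v ξ) - bs‖ ≤ 16 * R ^ 2 / (‖ξ‖ - 20 * R) := by
    intro ξ hξ
    have ht : Tendsto (fun n => ‖Q (u n ξ) - b n‖) atTop (𝓝 ‖Q (v ξ) - bs‖) :=
      (((Q.continuous.tendsto _).comp (hpt ξ)).sub hb).norm
    exact le_of_tendsto' ht fun n =>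
      LimitTails.norm_sub_le_of_tails hR P Q (u n) (b n) (htP n) (htQ n) hξ
  -- `|ξ| → ∞` along `cocompact ℂ`
  have hnorm : Tendsto (fun ξ : ℂ => ‖ξ‖) (cocompact ℂ) atTop := tendsto_norm_cocompact_atTop
  refine ⟨?_, ?_, h3, ?_⟩
  · -- `Q ∘ v → b⋆`: squeeze by the majorant `16R²/(|ξ| - 20R) → 0`
    rw [tendsto_iff_norm_sub_tendsto_zero]
    have hden : Tendsto (fun ξ : ℂ => ‖ξ‖ - 20 * R) (cocompact ℂ) atTop := by
      simpa only [sub_eq_add_neg] using tendsto_atTop_add_const_right (cocompact ℂ) (-(20 * R)) hnorm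
    have hmaj : Tendsto (fun ξ : ℂ => 16 * R ^ 2 / (‖ξ‖ - 20 * R)) (cocompact ℂ) (𝓝 0) :=
      tendsto_const_nhds.div_atTop hden
    refine squeeze_zero' (Eventually.of_forall fun ξ => norm_nonneg _) ?_ hmaj
    filter_upwards [hnorm.eventually_ge_atTop (24 * R)] with ξ hξ
    exact hQv ξ hξ
  · -- `P (v ξ) - ξ → 0`: squeeze by the majorant `120R²/|ξ| → 0`
    have hmaj : Tendsto (fun ξ : ℂ => 120 * R ^ 2 / ‖ξ‖) (cocompact ℂ) (𝓝 0) :=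
      tendsto_const_nhds.div_atTop hnorm
    refine squeeze_zero_norm' ?_ hmaj
    filter_upwards [hnorm.eventually_ge_atTop (6 * R)] with ξ hξ
    exact h3 ξ hξ
  · -- crossings: bounded crossing parameters have a cluster point, which crosses
    intro c hc
    choose ξ hξ using fun n => h7 n c hc
    have hB : ∀ n, ξ n ∈ closedBall (0 : ℂ) (max (6 * R) (‖c‖ + 20 * R)) := fun n =>
      mem_closedBall_zero_iff.2 (LimitTails.norm_le_of_crossing hR P (u n) (htP n) (hξ n))
    obtain ⟨ξs, -, φ, hφ, hlim⟩ := (isCompact_closedBall (0 : ℂ) _).tendsto_subseq hB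
    refine ⟨ξs, ?_⟩
    have hconv : Tendsto (fun k => P (u (φ k) (ξ (φ k)))) atTop (𝓝 (P (v ξs))) :=
      (P.continuous.tendsto _).comp
        ((LimitTails.tendstoLocallyUniformly_subseq hloc hφ).tendsto_comp hv.continuousAt hlim)
    have hconst : Tendsto (fun k => P (u (φ k) (ξ (φ k)))) atTop (𝓝 c) :=
      tendsto_const_nhds.congr fun k => (hξ (φ k)).symm
    exact tendsto_nhds_unique hconv hconst

end Summit.SmoothPoincare4.SmoothPoincare4.Cruxes.TameOrBrodyR4.Sketch
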